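import Summits.QuantumFields.YangMills.Theorems.UnitScaleTiltProp7ExactCorrectorHNMember
import Literature.MathematicalPhysics.QuantumFieldTheory.Balaban1983to89.B15SU2ChartHolomorphic
import Literature.LinearAlgebra.Matrix.UnitaryGroupExpSurjective
import Literature.Analysis.Calculus.ExpDuhamel
import HarnessLib

/-!
# Route `UnitScaleTilt`, crux K1 «MinimiserStabilityRegPr» (stmt-QuantumFields-19200), route-R E′ path (α′): (J3) REALITY OF THE CHART REMAINDER AT THE MEMBER —
# the row `hNreal` of ✓ `Prop7ExactCorrectorMember.exists_exact_corrector_member'`: for `ψ ∈ S` (pinned, Hermitian, traceless) on the ball, the remainder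
# `N ψ = (−I)•(mlog(e^{cψ}·E·(R(𝒰)e^{cψ∘T})^*) − mlog E + c•D_𝒰ψ)` is pointwise HERMITIAN and TRACELESS (unitarity and unimodularity of the three factors, `log` of a special unitary
# near `1` is skew-Hermitian traceless, `D_𝒰` of a Hermitian traceless field is Hermitian traceless at a unitary background)

Cell `ym3-torus`, width seat `ym3-torus-px13` (gen 3); ★p1 g16 NAMER WORD 3 «px13: JUNCTION GO» (J3), sequel of ✓p678611 (J1)(J2)(J4).  THEOREMS ONLY (0 `def`, 0 `sorry`, 0 `instance`);
`--supports stmt-QuantumFields-19200`, count-neutral.  YM₃ on T³ is a ladder rung (R3), not the Clay problem; nothing here claims the stub, the crux, d = 4 or the gap.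

WHAT IS PROVED (ns `…Theorems.Prop7ExactCorrectorHNReality`).
* §1 matrix bookkeeping (`M_N(ℂ)`, `L²`-operator norm): `norm_mul_sub_one_le_add` (`‖ab − 1‖ ≤ ‖a − 1‖ + ‖b − 1‖` for `‖a‖ ≤ 1`), `norm_exp_sub_one_le_two_mul` (`‖e^A − 1‖ ≤ 2‖A‖` for `‖A‖ ≤ 1`),
  `su_unitary`, `su_det` (the two halves of `SU(N)` membership), `conj_su_rows` (`R(u)V` unitary with `det = 1`), `star_su_rows`.
* §2 ★★ `skew_traceless_mlog_chartArg` — for skew-Hermitian traceless `A, A′` with `‖A‖, ‖A′‖ ≤ 1∕400`, `E ∈ SU(2)` with `‖E − 1‖ < 1`, `‖mlog E‖ ≤ 1∕40`, and a special-unitary unit `u`: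
  `Q := e^{A}·E·(R(u)e^{A′})^*` satisfies `(mlog Q)^* = −mlog Q`, `tr mlog Q = 0`, and the same for `E`.
* §3 ★★★ `hNreal_member` — at run `K`, level `K − n`, `SU(2)` background `W`: for `ψ ∈ S` with `‖ψ‖ ≤ 1∕400`, `N ψ μ y` is Hermitian and traceless (`c` with `‖c‖ ≤ 1`, `c̄ = −c`; data
  `E ∈ SU(2)` bondwise with `‖E − 1‖ < 1`, `ℓ‖mlog E‖ ≤ s`, `40s ≤ ℓ`); ★★ `hNreal_member_row` — the MEMBER DOOR's displayed row verbatim (`ψ ∈ S → p ψ ≤ 3·C_L·s → …`) under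
  `1200·C_L·s ≤ 1`.
HONEST SCOPE.  Bookkeeping over landed letters (✓ `B7Prop2Explicit.star_mlog_eq_neg`, ✓ `B15SU2ChartHolomorphic.trace_mlog_eq_zero`, ✓ `exp_mem_specialUnitaryGroup_of_mem_skewAdjoint`,
✓ `Prop7LinearCorrectorReality.covD_map`); constants generous.

References: T. Bałaban, CMP 102 (1985) 277–309 [Balaban1985Variational] (Prop. 7 p.299); CMP 98 (1985) 17–51 [Balaban1985Averaging] ((22)–(23) p.21, (26)–(27) p.22);
CMP 99 (1985) 389–434 [Balaban1985BackgroundPropagators] ((3.3) p.390, (3.5) p.391).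
-/

set_option autoImplicit false

noncomputable section

open scoped BigOperators Matrix.Norms.L2Operator Matrix
open NormedSpace

namespace Summit.QuantumFields.YangMills.Theorems.Prop7ExactCorrectorHNReality

open Literature.MathematicalPhysics.QuantumFieldTheory.Balaban1983to89
open Literature.MathematicalPhysics.QuantumFieldTheory.Balaban1983to89.T3ContinuumYM3Torus
open MatrixLog (mlog)
open B9Eq39Adjoint (R R_def R_sub R_apply_one covD)
open B9TorusCalculus (torusT)
open B15DeterminingSets (embIter)
open B10Eq27TorusAxialLog (unitsField toUField)
open Summit.QuantumFields.YangMills.Theorems.Prop7ExactCorrectorHNMember (norm_R_eq star_R_eq)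
open Summit.QuantumFields.YangMills.Theorems.Prop7ExactCorrectorGaugeSockets (unitsField_toUField_norm_le_one)
open Summit.QuantumFields.YangMills.Theorems.Prop7CovHodgeSplit (unitsField_toUField_mem_unitary)
open Summit.QuantumFields.YangMills.Theorems.Prop7ChartRemainderZero (star_smul_of_hermitian)

/-! ## §1 Matrix bookkeeping -/

section MatrixRows

variable {N : ℕ}

/-- `‖ab − 1‖ ≤ ‖a − 1‖ + ‖b − 1‖` when `‖a‖ ≤ 1`. [folklore] -/
theorem norm_mul_sub_one_le_add (a b : Matrix (Fin N) (Fin N) ℂ) (ha : ‖a‖ ≤ 1) : ‖a * b - 1‖ ≤ ‖a - 1‖ + ‖b - 1‖ := by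
  have e : a * b - 1 = a * (b - 1) + (a - 1) := by noncomm_ring
  rw [e]
  calc ‖a * (b - 1) + (a - 1)‖ ≤ ‖a * (b - 1)‖ + ‖a - 1‖ := norm_add_le _ _
    _ ≤ ‖a‖ * ‖b - 1‖ + ‖a - 1‖ := by gcongr; exact norm_mul_le _ _
    _ ≤ 1 * ‖b - 1‖ + ‖a - 1‖ := by gcongr
    _ = ‖a - 1‖ + ‖b - 1‖ := by ring

/-- `‖e^A − 1‖ ≤ 2‖A‖` for `‖A‖ ≤ 1` (`e^t − 1 ≤ 2t` on `[0,1]`). [folklore] -/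
theorem norm_exp_sub_one_le_two_mul [NeZero N] (A : Matrix (Fin N) (Fin N) ℂ) (hA : ‖A‖ ≤ 1) : ‖exp A - 1‖ ≤ 2 * ‖A‖ := by
  letI : CStarAlgebra (Matrix (Fin N) (Fin N) ℂ) := B10Eq29TubeLine.cstarAlgebraMatrix N
  have h := Literature.Analysis.Calculus.norm_exp_sub_one_le A
  have h2 : Real.exp ‖A‖ - 1 ≤ 2 * ‖A‖ := by
    have h3 := Real.abs_exp_sub_one_le (x := ‖A‖) (by rw [abs_of_nonneg (norm_nonneg _)]; exact hA)
    rw [abs_of_nonneg (norm_nonneg A)] at h3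
    exact (le_abs_self _).trans h3
  exact h.trans h2

/-- the unitary half of `SU(N)` membership. [folklore] -/
theorem su_unitary {M : Matrix (Fin N) (Fin N) ℂ} (hM : M ∈ Matrix.specialUnitaryGroup (Fin N) ℂ) : M ∈ unitary (Matrix (Fin N) (Fin N) ℂ) :=
  (Matrix.mem_specialUnitaryGroup_iff.1 hM).1

/-- the determinant half of `SU(N)` membership. [folklore] -/
theorem su_det {M : Matrix (Fin N) (Fin N) ℂ} (hM : M ∈ Matrix.specialUnitaryGroup (Fin N) ℂ) : M.det = 1 :=
  (Matrix.mem_specialUnitaryGroup_iff.1 hM).2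

/-- `R(u)V = uVu⁻¹` is unitary with `det = 1` when `u`, `V` are. [cite: Balaban1985BackgroundPropagators, (3.5) p.391] -/
theorem conj_su_rows {u : (Matrix (Fin N) (Fin N) ℂ)ˣ} (hu : (u : Matrix (Fin N) (Fin N) ℂ) ∈ unitary (Matrix (Fin N) (Fin N) ℂ))
    {V : Matrix (Fin N) (Fin N) ℂ} (hV : V ∈ unitary (Matrix (Fin N) (Fin N) ℂ)) (hVd : V.det = 1) :
    R u V ∈ unitary (Matrix (Fin N) (Fin N) ℂ) ∧ (R u V).det = 1 := by
  have hinv : ((u⁻¹ : (Matrix (Fin N) (Fin N) ℂ)ˣ) : Matrix (Fin N) (Fin N) ℂ) ∈ unitary (Matrix (Fin N) (Fin N) ℂ) :=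
    Prop7CovariantCoercivity.inv_mem_unitary hu
  refine ⟨?_, ?_⟩
  · rw [R_def]
    exact mul_mem (mul_mem hu hV) hinv
  · rw [R_def, Matrix.det_units_conj, hVd]

/-- `V^*` is unitary with `det = 1` when `V` is. [folklore] -/
theorem star_su_rows {V : Matrix (Fin N) (Fin N) ℂ} (hV : V ∈ unitary (Matrix (Fin N) (Fin N) ℂ)) (hVd : V.det = 1) :
    star V ∈ unitary (Matrix (Fin N) (Fin N) ℂ) ∧ (star V).det = 1 := by
  refine ⟨Unitary.star_mem hV, ?_⟩
  rw [Matrix.star_eq_conjTranspose, Matrix.det_conjTranspose, hVd, star_one]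

end MatrixRows

/-! ## §2 The logarithm of the chart argument is skew-Hermitian and traceless -/

/-- ★★ **`mlog(e^{A}·E·(R(u)e^{A′})^*)` IS SKEW-HERMITIAN AND TRACELESS** for skew-Hermitian traceless `A, A′` with `‖A‖, ‖A′‖ ≤ 1∕400`, `E ∈ SU(2)` with `‖E − 1‖ < 1` and
`‖mlog E‖ ≤ 1∕40`, `u` a unit with special-unitary value; and so is `mlog E`. [cite: Balaban1985Averaging, (22)-(23) p.21, (26)-(27) p.22] -/
theorem skew_traceless_mlog_chartArg {A A' E : Matrix (Fin 2) (Fin 2) ℂ} {u : (Matrix (Fin 2) (Fin 2) ℂ)ˣ}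
    (hA : A ∈ skewAdjoint (Matrix (Fin 2) (Fin 2) ℂ)) (hAt : A.trace = 0) (hAn : ‖A‖ ≤ 1 / 400)
    (hA' : A' ∈ skewAdjoint (Matrix (Fin 2) (Fin 2) ℂ)) (hA't : A'.trace = 0) (hA'n : ‖A'‖ ≤ 1 / 400)
    (hE : E ∈ Matrix.specialUnitaryGroup (Fin 2) ℂ) (hE1 : ‖E - 1‖ < 1) (hEβ : ‖mlog E‖ ≤ 1 / 40)
    (hu : (u : Matrix (Fin 2) (Fin 2) ℂ) ∈ Matrix.specialUnitaryGroup (Fin 2) ℂ)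
    (hu1 : ‖(u : Matrix (Fin 2) (Fin 2) ℂ)‖ ≤ 1 ∧ ‖((u⁻¹ : (Matrix (Fin 2) (Fin 2) ℂ)ˣ) : Matrix (Fin 2) (Fin 2) ℂ)‖ ≤ 1) :
    star (mlog (exp A * E * star (R u (exp A')))) = -mlog (exp A * E * star (R u (exp A'))) ∧
      (mlog (exp A * E * star (R u (exp A')))).trace = 0 ∧
      star (mlog E) = -mlog E ∧ (mlog E).trace = 0 := by
  letI : CStarAlgebra (Matrix (Fin 2) (Fin 2) ℂ) := B10Eq29TubeLine.cstarAlgebraMatrix 2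
  -- the three factors are special unitary
  have heA := Literature.LinearAlgebra.Matrix.exp_mem_specialUnitaryGroup_of_mem_skewAdjoint hA hAt
  have heA' := Literature.LinearAlgebra.Matrix.exp_mem_specialUnitaryGroup_of_mem_skewAdjoint hA' hA't
  have hV := conj_su_rows (su_unitary hu) (su_unitary heA') (su_det heA')
  have hF := star_su_rows hV.1 hV.2
  have hQu : exp A * E * star (R u (exp A')) ∈ unitary (Matrix (Fin 2) (Fin 2) ℂ) :=
    mul_mem (mul_mem (su_unitary heA) (su_unitary hE)) hF.1
  have hQd : (exp A * E * star (R u (exp A'))).det = 1 := by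
    rw [Matrix.det_mul, Matrix.det_mul, su_det heA, su_det hE, hF.2]; ring
  -- the three factors are close to `1`
  have h1 : ‖exp A - 1‖ ≤ 1 / 200 := (norm_exp_sub_one_le_two_mul A (by linarith)).trans (by linarith)
  have h2 : ‖E - 1‖ ≤ 1 / 20 := by
    have h := MatrixLog.norm_sub_one_le_exp_norm_mlog_sub_one hE1
    have h3 := Real.abs_exp_sub_one_le (x := ‖mlog E‖) (by rw [abs_of_nonneg (norm_nonneg _)]; linarith)
    rw [abs_of_nonneg (norm_nonneg (mlog E))] at h3
    linarith [le_abs_self (Real.exp ‖mlog E‖ - 1)]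
  have h3 : ‖star (R u (exp A')) - 1‖ ≤ 1 / 200 := by
    have e : star (R u (exp A')) - 1 = star (R u (exp A' - 1)) := by
      rw [R_sub, R_apply_one, star_sub, star_one]
    rw [e, norm_star, norm_R_eq hu1]
    exact (norm_exp_sub_one_le_two_mul A' (by linarith)).trans (by linarith)
  have hn1 : ‖exp A‖ ≤ 1 := (CStarRing.norm_of_mem_unitary (su_unitary heA)).le
  have hn2 : ‖exp A * E‖ ≤ 1 := (CStarRing.norm_of_mem_unitary (mul_mem (su_unitary heA) (su_unitary hE))).le
  have hQ1 : ‖exp A * E * star (R u (exp A')) - 1‖ ≤ 1 / 4 := by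
    have t1 := norm_mul_sub_one_le_add (exp A * E) (star (R u (exp A'))) hn2
    have t2 := norm_mul_sub_one_le_add (exp A) E hn1
    linarith
  refine ⟨B7Prop2Explicit.star_mlog_eq_neg hQu hQ1, B15SU2ChartHolomorphic.trace_mlog_eq_zero (by linarith) hQd,
    B7Prop2Explicit.star_mlog_eq_neg (su_unitary hE) (by linarith), B15SU2ChartHolomorphic.trace_mlog_eq_zero (by linarith) (su_det hE)⟩

/-! ## §3 At the member: the MEMBER DOOR's `hNreal` row -/

/-- ★★★ **(J3) THE REMAINDER IS HERMITIAN AND TRACELESS ON `S` (on the ball).**  Run `K`, level `K − n`, `SU(2)` background `W`, `𝒰 = unitsField (toUField W)`; scalar `c` with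
`‖c‖ ≤ 1`, `c̄ = −c`; bondwise data `E ∈ SU(2)`, `‖E − 1‖ < 1`, `ℓ‖mlog E‖ ≤ s`, `40s ≤ ℓ`; the remainder `N` displayed as in ✓ `hN_member`.  For `ψ` pinned Hermitian traceless with
`‖ψ‖ ≤ 1∕400`: `(N ψ μ y)ᴴ = N ψ μ y` and `tr (N ψ μ y) = 0`. [cite: Balaban1985Variational, Prop. 7 p.299; Balaban1985Averaging, (22)-(23) p.21] -/
theorem hNreal_member (F : T3Family) (K n : ℕ) (W : GaugeField (F.P K) 0 (Matrix.specialUnitaryGroup (Fin 2) ℂ))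
    {c : ℂ} (hc : ‖c‖ ≤ 1) (hcs : star c = -c)
    (En : Fin (F.P K).d → Site (F.P K) 0 → Matrix (Fin 2) (Fin 2) ℂ) (hEn : ∀ μ y, En μ y ∈ Matrix.specialUnitaryGroup (Fin 2) ℂ)
    (hE1 : ∀ μ y, ‖En μ y - 1‖ < 1) {s : ℝ}
    (hEβ : ∀ μ y, (F.L : ℝ) ^ (K - n) * ‖mlog (En μ y)‖ ≤ s) (hs40 : 40 * s ≤ (F.L : ℝ) ^ (K - n))
    (Nf : (Site (F.P K) 0 → Matrix (Fin 2) (Fin 2) ℂ) → (Fin (F.P K).d → Site (F.P K) 0 → Matrix (Fin 2) (Fin 2) ℂ))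
    (hNf : ∀ ψ μ y, Nf ψ μ y = (-Complex.I) • (mlog (exp (c • ψ y) * En μ y
        * star (R (unitsField (toUField W) ⟨y, μ⟩) (exp (c • ψ (torusT (F.P K) 0 μ y))))) - mlog (En μ y)
        + c • covD (torusT (F.P K) 0) (fun κ z => unitsField (toUField W) ⟨z, κ⟩) μ ψ y))
    (ψ : Site (F.P K) 0 → Matrix (Fin 2) (Fin 2) ℂ)
    (hψS : ψ ∈ {ψ : Site (F.P K) 0 → Matrix (Fin 2) (Fin 2) ℂ | (∀ c ∈ Set.range (embIter (K - n)), ψ c = 0) ∧ ∀ x, (ψ x)ᴴ = ψ x ∧ (ψ x).trace = 0})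
    (hψn : ‖ψ‖ ≤ 1 / 400) (μ : Fin (F.P K).d) (y : Site (F.P K) 0) :
    (Nf ψ μ y)ᴴ = Nf ψ μ y ∧ (Nf ψ μ y).trace = 0 := by
  obtain ⟨-, hψHT⟩ := hψS
  have hℓ0 : (0 : ℝ) < (F.L : ℝ) ^ (K - n) := pow_pos (by have := F.hL.2; exact_mod_cast (by omega : 0 < F.L)) _
  -- the scalar rows
  have hskew : ∀ z, star (c • ψ z) = -(c • ψ z) := fun z =>
    star_smul_of_hermitian hcs (by rw [Matrix.star_eq_conjTranspose]; exact (hψHT z).1)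
  have hskA : ∀ z, c • ψ z ∈ skewAdjoint (Matrix (Fin 2) (Fin 2) ℂ) := fun z => skewAdjoint.mem_iff.2 (hskew z)
  have htrA : ∀ z, (c • ψ z).trace = 0 := fun z => by rw [Matrix.trace_smul, (hψHT z).2, smul_zero]
  have hnA : ∀ z, ‖c • ψ z‖ ≤ 1 / 400 := fun z => by
    calc ‖c • ψ z‖ = ‖c‖ * ‖ψ z‖ := norm_smul _ _
      _ ≤ 1 * ‖ψ‖ := mul_le_mul hc (norm_le_pi_norm ψ z) (norm_nonneg _) zero_le_one
      _ ≤ 1 / 400 := by rw [one_mul]; exact hψn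
  -- the background unit is special unitary
  have hUsu : ((unitsField (toUField W) ⟨y, μ⟩ : (Matrix (Fin 2) (Fin 2) ℂ)ˣ) : Matrix (Fin 2) (Fin 2) ℂ) ∈ Matrix.specialUnitaryGroup (Fin 2) ℂ := by
    have e : ((unitsField (toUField W) ⟨y, μ⟩ : (Matrix (Fin 2) (Fin 2) ℂ)ˣ) : Matrix (Fin 2) (Fin 2) ℂ)
        = ((W ⟨y, μ⟩ : Matrix.specialUnitaryGroup (Fin 2) ℂ) : Matrix (Fin 2) (Fin 2) ℂ) := by
      rw [B10Eq27TorusAxialLog.val_unitsField]; rfl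
    rw [e]; exact (W ⟨y, μ⟩).2
  have hU1 := unitsField_toUField_norm_le_one W ⟨y, μ⟩
  have hβ : ‖mlog (En μ y)‖ ≤ 1 / 40 := by
    have h1 : ‖mlog (En μ y)‖ ≤ s / (F.L : ℝ) ^ (K - n) := by rw [le_div_iff₀ hℓ0, mul_comm]; exact hEβ μ y
    have h2 : s / (F.L : ℝ) ^ (K - n) ≤ 1 / 40 := by rw [div_le_iff₀ hℓ0]; linarith
    exact h1.trans h2
  obtain ⟨hQs, hQt, hEs, hEt⟩ := skew_traceless_mlog_chartArg (hskA y) (htrA y) (hnA y) (hskA _) (htrA _) (hnA (torusT (F.P K) 0 μ y))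
    (hEn μ y) (hE1 μ y) hβ hUsu hU1
  -- the covariant difference of a Hermitian traceless field is Hermitian traceless
  have hDH : star (covD (torusT (F.P K) 0) (fun κ z => unitsField (toUField W) ⟨z, κ⟩) μ ψ y)
      = covD (torusT (F.P K) 0) (fun κ z => unitsField (toUField W) ⟨z, κ⟩) μ ψ y := by
    simp only [covD, star_sub, star_R_eq (unitsField_toUField_mem_unitary W μ y), Matrix.star_eq_conjTranspose, (hψHT _).1]
  have hDT : (covD (torusT (F.P K) 0) (fun κ z => unitsField (toUField W) ⟨z, κ⟩) μ ψ y).trace = 0 := by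
    simp only [covD, R_def, Matrix.trace_sub, Matrix.trace_mul_cycle _ (ψ _), Units.inv_mul, Matrix.one_mul, (hψHT _).2, sub_self]
  -- assembly
  have hstarI : star (-Complex.I) = Complex.I := by rw [star_neg, Complex.star_def, Complex.conj_I, neg_neg]
  constructor
  · rw [hNf, ← Matrix.star_eq_conjTranspose, star_smul, hstarI, star_add, star_sub, hQs, hEs, star_smul, hcs, hDH]
    -- `I • (−q − (−e) + (−c)•D) = (−I) • (q − e + c•D)`
    simp only [neg_smul, smul_neg, sub_neg_eq_add, smul_add, smul_sub]
  · rw [hNf, Matrix.trace_smul, Matrix.trace_add, Matrix.trace_sub, hQt, hEt, Matrix.trace_smul, hDT, smul_zero, sub_zero, zero_add, smul_zero]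


/-- ★★ **THE MEMBER DOOR's `hNreal` ROW VERBATIM** (✓ `exists_exact_corrector_member'`): under `‖ψ‖ ≤ p ψ` (✓ `gauge_norm_le`) and the smallness `3·C·s′ ≤ 1∕400` of the ball radius,
`∀ ψ ∈ S, p ψ ≤ 3·C·s′ → N ψ` is pointwise Hermitian and traceless. [cite: Balaban1985Variational, Prop. 7 p.299] -/
theorem hNreal_member_row (F : T3Family) (K n : ℕ) (W : GaugeField (F.P K) 0 (Matrix.specialUnitaryGroup (Fin 2) ℂ))
    {c : ℂ} (hc : ‖c‖ ≤ 1) (hcs : star c = -c)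
    (En : Fin (F.P K).d → Site (F.P K) 0 → Matrix (Fin 2) (Fin 2) ℂ) (hEn : ∀ μ y, En μ y ∈ Matrix.specialUnitaryGroup (Fin 2) ℂ)
    (hE1 : ∀ μ y, ‖En μ y - 1‖ < 1) {s : ℝ}
    (hEβ : ∀ μ y, (F.L : ℝ) ^ (K - n) * ‖mlog (En μ y)‖ ≤ s) (hs40 : 40 * s ≤ (F.L : ℝ) ^ (K - n))
    (Nf : (Site (F.P K) 0 → Matrix (Fin 2) (Fin 2) ℂ) → (Fin (F.P K).d → Site (F.P K) 0 → Matrix (Fin 2) (Fin 2) ℂ))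
    (hNf : ∀ ψ μ y, Nf ψ μ y = (-Complex.I) • (mlog (exp (c • ψ y) * En μ y
        * star (R (unitsField (toUField W) ⟨y, μ⟩) (exp (c • ψ (torusT (F.P K) 0 μ y))))) - mlog (En μ y)
        + c • covD (torusT (F.P K) 0) (fun κ z => unitsField (toUField W) ⟨z, κ⟩) μ ψ y))
    (p : (Site (F.P K) 0 → Matrix (Fin 2) (Fin 2) ℂ) → ℝ) (hpn : ∀ ψ, ‖ψ‖ ≤ p ψ) {C s' : ℝ} (hsmall : 3 * C * s' ≤ 1 / 400) :
    ∀ ψ, ψ ∈ {ψ : Site (F.P K) 0 → Matrix (Fin 2) (Fin 2) ℂ | (∀ c ∈ Set.range (embIter (K - n)), ψ c = 0) ∧ ∀ x, (ψ x)ᴴ = ψ x ∧ (ψ x).trace = 0} →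
      p ψ ≤ 3 * C * s' → ∀ (μ : Fin (F.P K).d) (x : Site (F.P K) 0), (Nf ψ μ x)ᴴ = Nf ψ μ x ∧ (Nf ψ μ x).trace = 0 :=
  fun ψ hψS hψB μ x => hNreal_member F K n W hc hcs En hEn hE1 hEβ hs40 Nf hNf ψ hψS (((hpn ψ).trans hψB).trans hsmall) μ x

end Summit.QuantumFields.YangMills.Theorems.Prop7ExactCorrectorHNReality

end
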